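import Summits.QuantumFields.BalabanUV.T4Continuum.Spine.NE3.FrameNormalisationOneLevel
import HarnessLib

/-!
# T⁴ programme, node NE3 — census R50 open half (M1), FOURTH BRICK: the `k`-fold double-bar average and the accumulated frame under an ARBITRARY gauge — the TWISTED TOWER,
# and the frame condition as the FIXED-POINT EQUATION `v(L^kz) = u₀(L^kz)⁻¹ · 𝔳_k(z)` on the top corner data (`FrameNormalisationTower`)

Cell `pub-balaban-gaps` (track G2, seat ne3, generation 11), row NE3; census `HOME/ne/NE3.md` §4 R50, §17 (M1).  `FrameNormalisation.dbavgCovIter_vcov_mgauge_of_hier` iterates the EXACT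
one-step covariance of (89) (block-covariantly-constant gauges) through the `k` levels; `FrameNormalisationDefect.dbavgCov_mgauge_of_wframe` is the one-step law for an ARBITRARY
gauge `v`, with the block frames of `V₁^{v}` written as `R(v(y)) w′(y)` (`w′` = the `δ`-twisted frames, `FrameNormalisationDefect.wframe_mgauge_general`).  This module iterates the
general law.  The towers are taken as HYPOTHESES on three sequences (no definition is made): `D : ℕ → cfg` (the twisted double-bar tower, `D⁰ = U′`,
`D^{j+1}(z,κ) = w′ʲ(Lz)⁻¹ · Ṽ[Ū₀ʲ, Dʲ](Lz,κ) · R(\overline{Ū₀ʲ}(Lz,κ)) w′ʲ(Lz + Le_κ)`), `w′ : ℕ → gauge` (the twisted block frames at each level: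
`w[Ū₀ʲ]((Dʲ)^{v_j})(y) = R(v_j(y)) w′ʲ(y)`, which `wframe_mgauge_general` supplies) and `𝔳 : ℕ → gauge` (the twisted accumulated frame, `𝔳₀ = 1`, `𝔳_{j+1}(z) = 𝔳_j(Lz)·w′ʲ(Lz)`):

* §1 **`tower_mgauge_general`** — for every `j`: `(U′^{v})̿ʲ = (Dʲ)^{v_j}` (moving frame relative to `Ū₀ʲ`, corner values `v_j = uLev L v j`) and `v_j(U′^{v})(z) = R(v_j(z)) 𝔳_j(z)`
  (induction; the one-step law inlined from (89) + (59)∕(93) `tild_mgauge`; the corner values at a coarser corner are the same group element, `uLev_smul`).  With `w′ʲ` the plain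
  frames of the exact tower this is `dbavgCovIter_vcov_mgauge_of_hier` again.
* §2 **`frameCondition_iff_topData`** — under the tower, the frame condition `vcov L W (U′^{v}) k = uLev L (v·u₀) k` of `PairFrameCondition` ∕ `FrameNormalisation` is EQUIVALENT to the
  equation on the top corner data **`v(L^kz) = u₀(L^kz)⁻¹ · 𝔳_k(z)`** — the FIXED-POINT EQUATION of (M1): `𝔳_k` depends on `v` (through the covariant block oscillations `δ_v` at all
  levels, `FrameNormalisationDefect`), Lipschitz-small in them (`FrameNormalisationDefectSize`), which are in turn `≤ d·L·G` for a gauge with covariant bond gradients within `G` of `1`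
  (`FrameNormalisationOscillation`); in the exact case `𝔳_k = v_k(U₀′)` and the equation is the explicit top datum of `FrameNormalisation.frameCondition'`.

HONEST FRAMING (page 1).  Group algebra on the tree's formal objects (0 def, 0 sorry); the contraction (existence of the fixed point for the smooth corner interpolant (154e), jointly
with (1.38)) is NOT done here — that is what remains of (M1); nothing of Bałaban's asserted; **NE3 NOT proved**; `PairLandauGaugeB8Avg` and the covariant root NOT proved; spine PROVED
0∕9; finite T⁴ rung (B)+1 — NOT continuum YM on ℝ⁴, NOT infinite volume, NOT mass gap, NOT `BetaPertH`, NOT Clay.  HONEST DEPENDENCY: continuum YM on T⁴ ⇐ BetaPertH ∧ nine spine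
estimates (0/9 proved); BetaPertH ⇐ (D1) ∧ (D4) ∧ CAP+tail; G-an2-4 gates asym, D1 and NE2/3/4.  PLACEMENT: `Summits/QuantumFields/BalabanUV/T4Continuum/Spine/NE3/`; imports
`FrameNormalisationOneLevel` only.

References: [Balaban1985Averaging] T. Bałaban, *Averaging operations for lattice gauge theories*, CMP 98 (1985) 17–51: (59) p. 27, (89)–(93) pp. 31–32, (96)–(99) p. 32;
[Balaban1985RegularSpaces] CMP 99 (1985), (1.29) p. 80, (1.37) p. 82, (1.100) p. 98.
-/

set_option autoImplicit false

open scoped BigOperators Matrix Matrix.Norms.L2Operator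
open NormedSpace

namespace Summit.QuantumFields.BalabanUV.T4Continuum.NE3.FrameNormalisationTower

open Literature.MathematicalPhysics.QuantumFieldTheory.Balaban1983to89
open B7Prop1Explicit B7Prop2Explicit
open B7AvgGaugeCovariance (uLev uLev_apply uLev_zero uLev_smul)
open B7Eq92Concrete (Rc Rc_apply mgauge mgauge_apply wframe tild tild_mgauge dbavgCov dbavgCov_apply dbavgCovIter dbavgCovIter_zero dbavgCovIter_succ
  vcov vcov_zero vcov_succ)

noncomputable section

variable {d : ℕ} {n : Type*} [Fintype n] [DecidableEq n]

/-! ## §1 The twisted tower -/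

/-- **THE `j`-FOLD DOUBLE-BAR AVERAGE AND THE ACCUMULATED FRAME OF `U′^{v}` FOR AN ARBITRARY GAUGE `v`**: given the twisted block frames `w′ʲ` of each level
(`w[Ū₀ʲ]((Dʲ)^{v_j})(y) = R(v_j(y)) w′ʲ(y)`), the twisted double-bar tower `Dʲ` and the twisted accumulated frame `𝔳_j` built from them, for every `j`:
`(U′^{v})̿ʲ = (Dʲ)^{v_j}` relative to `Ū₀ʲ` and `v_j(U′^{v})(z) = R(v_j(z)) 𝔳_j(z)`. [folklore] -/
theorem tower_mgauge_general (L : ℕ) (W U' : Site d → Fin d → (Matrix n n ℂ)ˣ) (v : Site d → (Matrix n n ℂ)ˣ)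
    (D : ℕ → Site d → Fin d → (Matrix n n ℂ)ˣ) (w' 𝔳 : ℕ → Site d → (Matrix n n ℂ)ˣ)
    (hD0 : D 0 = U') (h𝔳0 : ∀ z : Site d, 𝔳 0 z = 1)
    (hw : ∀ (j : ℕ) (y : Site d), wframe L (avgIter L W j) (mgauge (avgIter L W j) (uLev L v j) (D j)) y = Rc (uLev L v j y) (w' j y))
    (hD : ∀ (j : ℕ) (z : Site d) (κ : Fin d), D (j + 1) z κ
      = (w' j ((L : ℤ) • z))⁻¹ * tild L (avgIter L W j) (D j) ((L : ℤ) • z) κ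
          * Rc (bavg L (avgIter L W j) ((L : ℤ) • z) κ) (w' j ((L : ℤ) • z + (L : ℤ) • e κ)))
    (h𝔳 : ∀ (j : ℕ) (z : Site d), 𝔳 (j + 1) z = 𝔳 j ((L : ℤ) • z) * w' j ((L : ℤ) • z)) :
    ∀ j : ℕ, dbavgCovIter L W (mgauge W v U') j = mgauge (avgIter L W j) (uLev L v j) (D j) ∧
      ∀ z : Site d, vcov L W (mgauge W v U') j z = Rc (uLev L v j z) (𝔳 j z)
  | 0 => by
    refine ⟨?_, fun z => ?_⟩
    · rw [dbavgCovIter_zero, avgIter_zero, uLev_zero, hD0]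
    · rw [vcov_zero, h𝔳0, map_one]
  | j + 1 => by
    obtain ⟨hd, hv⟩ := tower_mgauge_general L W U' v D w' 𝔳 hD0 h𝔳0 hw hD h𝔳 j
    refine ⟨?_, fun z => ?_⟩
    · funext z κ
      rw [dbavgCovIter_succ, hd, dbavgCov_apply, hw, hw, tild_mgauge, mgauge_apply, hD, avgIter_succ, rescale_apply, uLev_smul, ← smul_add, uLev_smul]
      simp only [Rc_apply, map_mul, map_inv, mul_inv_rev, inv_inv]
      group
    · rw [vcov_succ, hv, hd, hw, h𝔳, uLev_smul, ← map_mul]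

/-! ## §2 The frame condition as the fixed-point equation on the top corner data -/

/-- **THE FRAME CONDITION ⟺ `v(L^kz) = u₀(L^kz)⁻¹ · 𝔳_k(z)`**: under the twisted tower of §1, `vcov L W (U′^{v}) k = uLev L (v·u₀) k` holds iff the top corner values of `v` solve the
fixed-point equation with the twisted accumulated frame `𝔳_k` (which depends on `v` through its covariant block oscillations).  In the exact case (`𝔳_k = v_k(U₀′)`) this is the top
datum of `FrameNormalisation.frameCondition'`. [folklore] -/
theorem frameCondition_iff_topData (L k : ℕ) (W U' : Site d → Fin d → (Matrix n n ℂ)ˣ) (v u₀ : Site d → (Matrix n n ℂ)ˣ)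
    (D : ℕ → Site d → Fin d → (Matrix n n ℂ)ˣ) (w' 𝔳 : ℕ → Site d → (Matrix n n ℂ)ˣ)
    (hD0 : D 0 = U') (h𝔳0 : ∀ z : Site d, 𝔳 0 z = 1)
    (hw : ∀ (j : ℕ) (y : Site d), wframe L (avgIter L W j) (mgauge (avgIter L W j) (uLev L v j) (D j)) y = Rc (uLev L v j y) (w' j y))
    (hD : ∀ (j : ℕ) (z : Site d) (κ : Fin d), D (j + 1) z κ
      = (w' j ((L : ℤ) • z))⁻¹ * tild L (avgIter L W j) (D j) ((L : ℤ) • z) κ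
          * Rc (bavg L (avgIter L W j) ((L : ℤ) • z) κ) (w' j ((L : ℤ) • z + (L : ℤ) • e κ)))
    (h𝔳 : ∀ (j : ℕ) (z : Site d), 𝔳 (j + 1) z = 𝔳 j ((L : ℤ) • z) * w' j ((L : ℤ) • z)) :
    vcov L W (mgauge W v U') k = uLev L (v * u₀) k ↔
      ∀ z : Site d, v (((L : ℤ) ^ k) • z) = (u₀ (((L : ℤ) ^ k) • z))⁻¹ * 𝔳 k z := by
  have hv := (tower_mgauge_general L W U' v D w' 𝔳 hD0 h𝔳0 hw hD h𝔳 k).2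
  constructor
  · intro h z
    have hz := congrFun h z
    rw [hv z, Rc_apply, uLev_apply, uLev_apply, Pi.mul_apply, mul_assoc] at hz
    -- `v·(𝔳·v⁻¹) = v·u₀` ⟹ `𝔳·v⁻¹ = u₀` ⟹ `v = u₀⁻¹·𝔳`
    have h2 : 𝔳 k z * (v (((L : ℤ) ^ k) • z))⁻¹ = u₀ (((L : ℤ) ^ k) • z) := mul_left_cancel hz
    rw [eq_inv_mul_iff_mul_eq, ← h2, inv_mul_cancel_right]
  · intro h
    funext z
    rw [hv z, Rc_apply, uLev_apply, uLev_apply, Pi.mul_apply]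
    have h2 : 𝔳 k z = u₀ (((L : ℤ) ^ k) • z) * v (((L : ℤ) ^ k) • z) := by
      rw [h z, mul_inv_cancel_left]
    rw [h2]
    group

end

end Summit.QuantumFields.BalabanUV.T4Continuum.NE3.FrameNormalisationTower
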